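import Mathlib
import Summits.NavierStokesRegularity.NavierStokesRegularity.Theorems.EulerZoomLiouvillePowerGaugeEulerLiouvilleCondenserInfiniteType
import Summits.NavierStokesRegularity.NavierStokesRegularity.Theorems.EulerZoomLiouvillePowerGaugeEulerLiouvilleNeedleClockPast
import Summits.NavierStokesRegularity.NavierStokesRegularity.Theorems.EulerZoomLiouvillePowerGaugeEulerLiouvilleSelfSimilarPastStrata

/-!
# Infinite-type / finite-type-gradient kill — past-exact twin (T-M)

Sub-problem `NavierStokesRegularity`, crux `PowerGaugeEulerLiouville` (a crux CLASS of self-similar Euler/NS strata — not NS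
regularity).  Past-exact twin of `Condenser.selfSimilar_ae_eq_zero_of_finiteTypeGradientC2` (T3): a class member exactly
self-similar about `(T, x₀)` for `τ < T₁` (`T₁ ≤ 0`, `T₁ ≤ T`) with `C²` profile of FINITE TYPE (gradient `≤ exp(C R^{2+ρ})` on
`B_{3R}` along an unbounded sequence of radii) is trivial — GIVEN the weighted dissipation integral of the profile,
`∫⁻ ‖DV‖ₑ² ‖y‖^{ρ−1} < ∞` (hypothesis `hEw`).

Why `hEw` is a hypothesis here and not derived (unlike the centred (T3), where it is `NeedleThinCore.selfSimilar_needle_inputs`.2):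
for a member exact only for `τ < T₁ < T` the `E`-gauge cylinder `Q_a(0,0)` sees the profile gradient, in similarity variables, only
on the window of radii `[(a−‖x₀‖)(T+a²)^{−γ}, (a−‖x₀‖)(T−T₁)^{−γ}]` (log-width `≈ 2γ log a`), with the constraint
`∫_{window} r^{ρ−1} (∫_{B_r}‖DV‖²) dr/r ≤ γ c (a/(a−‖x₀‖))^{1−ρ}`; sparse saturated scales (`r_i^{ρ−1}∫_{B_{r_i}}‖DV‖² = ε`,
`log log r_i ∈ ℕ`, `ε ≤ γ(1−ρ)c/4`) are compatible with every such window bound, so the gauges alone do not give the o-form for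
`T₁ < T`; for `T = T₁` the window is `[·, ∞)` and `hEw` follows as in the centred case (`profile_gradient_weight_of_gaugeE`).
-/

noncomputable section

open Set Filter Topology Metric Function MeasureTheory Real
open scoped RealInnerProductSpace NNReal ENNReal

set_option linter.dupNamespace false

namespace Summit.NavierStokesRegularity.NavierStokesRegularity.Theorems.PowerGaugeEulerLiouville.Condenser

open Literature.Analysis Literature.Analysis.FluidPDE
open Summit.NavierStokesRegularity.NavierStokesRegularity.Theorems.PowerGaugeEulerLiouville

/-- **PAST-EXACT MEMBER, FINITE-TYPE `C²` PROFILE WITH WEIGHTED DISSIPATION, IS TRIVIAL (T-M, conditional on `hEw`).**  Crux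
hypotheses verbatim (`0 < ρ ≤ ½`) + exact self-similarity about `(T, x₀)` for `τ < T₁` (`T₁ ≤ 0`, `T₁ ≤ T`) + `V ∈ C²` +
`∫⁻ ‖DV‖ₑ²‖y‖^{ρ−1} ≤ E` + finite type `‖DV‖ ≤ exp(C R^{2+ρ})` on `B_{3R}` for an unbounded set of `R` ⇒ `u = 0` a.e. on
`(−∞,0) × ℝ³`.  Proof = (T3): classical pressure (`Past.exists_isSelfSimilarEulerProfile`), `A`-budget in O-form
(`NeedleRace.needleBudgets_of_selfSimilarC2_past`), `E`-budget in o-form from `hEw` (`lintegral_fderiv_sq_closedBall_eventually_le`)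
with the constant (T2) demands, (T2) `curl_eq_zero_of_typeGradient_le`, and the past irrotational kill. [folklore] -/
theorem selfSimilar_ae_eq_zero_of_finiteTypeGradientC2_past_of_weight {ρ T T₁ : ℝ} (hρ : 0 < ρ) (hρ1 : ρ ≤ 1 / 2)
    (hT₁ : T₁ ≤ 0) (hTT₁ : T₁ ≤ T) (x₀ : EuclideanSpace ℝ (Fin 3))
    {u : ℝ → EuclideanSpace ℝ (Fin 3) → EuclideanSpace ℝ (Fin 3)} {p : ℝ → EuclideanSpace ℝ (Fin 3) → ℝ}
    {H : ℝ → EuclideanSpace ℝ (Fin 3) → EuclideanSpace ℝ (Fin 3) →L[ℝ] EuclideanSpace ℝ (Fin 3)} {c : ℝ≥0}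
    (hsw : IsSuitableWeakSolutionOn (slab (EuclideanSpace ℝ (Fin 3)) (Iio 0) isOpen_Iio) 0 0 u p)
    (hH : HasWeakSpatialGradientOn (slab (EuclideanSpace ℝ (Fin 3)) (Iio 0) isOpen_Iio) u H)
    (hgauge : ∀ a : ℝ, 0 < a →
      ENNReal.ofReal (a ^ (2 * ρ)) * cknA a (0 : ℝ × EuclideanSpace ℝ (Fin 3)) u +
          ENNReal.ofReal (a ^ ρ) * cknE a (0 : ℝ × EuclideanSpace ℝ (Fin 3)) H +
        ENNReal.ofReal (a ^ (2 * ρ)) * cknD a (0 : ℝ × EuclideanSpace ℝ (Fin 3)) p ≤ (c : ℝ≥0∞))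
    {V : EuclideanSpace ℝ (Fin 3) → EuclideanSpace ℝ (Fin 3)} {P : EuclideanSpace ℝ (Fin 3) → ℝ}
    (hu : ∀ τ : ℝ, τ < T₁ → u τ = fun x => selfSimilarCollapse (1 / (2 + ρ)) T V τ (x - x₀))
    (hp : ∀ τ : ℝ, τ < T₁ → p τ = fun x => selfSimilarCollapsePressure (1 / (2 + ρ)) T P τ (x - x₀))
    (hV : ContDiff ℝ 2 V) {E : ℝ}
    (hEw : ∫⁻ y, ‖fderiv ℝ V y‖ₑ ^ 2 * ENNReal.ofReal (‖y‖ ^ (ρ - 1)) ≤ ENNReal.ofReal E)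
    (hgrad : ∃ C : ℝ, ∀ R₀ : ℝ, ∃ R : ℝ, R₀ ≤ R ∧
      ∀ z ∈ ball (0 : EuclideanSpace ℝ (Fin 3)) (3 * R), ‖fderiv ℝ V z‖ ≤ Real.exp (C * R ^ (2 + ρ))) :
    uncurry u =ᵐ[volume.restrict (Iio (0 : ℝ) ×ˢ (univ : Set (EuclideanSpace ℝ (Fin 3))))] 0 := by
  -- adapted from `Condenser.selfSimilar_ae_eq_zero_of_finiteTypeGradientC2` (…CondenserInfiniteType)
  have hρ1' : ρ < 1 := by linarith
  have h2ρ : (0 : ℝ) < 2 + ρ := by linarith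
  have hV1 : ContDiff ℝ 1 V := hV.of_le (by norm_num)
  obtain ⟨C, hgradC⟩ := hgrad
  -- WLOG `C ≥ 1`
  set C₁ : ℝ := max C 1 with hC₁
  have hC₁pos : 0 < C₁ := lt_of_lt_of_le one_pos (le_max_right _ _)
  have hgrad₁ : ∀ R₀ : ℝ, ∃ R : ℝ, R₀ ≤ R ∧
      ∀ z ∈ ball (0 : EuclideanSpace ℝ (Fin 3)) (3 * R), ‖fderiv ℝ V z‖ ≤ Real.exp (C₁ * R ^ (2 + ρ)) := by
    intro R₀
    obtain ⟨R, hR, h⟩ := hgradC (max R₀ 0)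
    refine ⟨R, (le_max_left _ _).trans hR, fun z hz => (h z hz).trans (Real.exp_le_exp.2 ?_)⟩
    exact mul_le_mul_of_nonneg_right (le_max_left _ _) (Real.rpow_nonneg ((le_max_right _ _).trans hR) _)
  -- ### a classical pressure for the profile (far-past extension)
  obtain ⟨P', hprof⟩ := Past.exists_isSelfSimilarEulerProfile hρ hT₁ hTT₁ hsw.distributional hu hp hV
  -- ### the class budgets of the profile: A in O-form from the far past
  have hA : ∀ a : ℝ, 0 < a → ENNReal.ofReal (a ^ (2 * ρ)) *
      cknA a (0 : ℝ × EuclideanSpace ℝ (Fin 3)) u ≤ (c : ℝ≥0∞) :=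
    fun a ha => le_trans (le_trans le_self_add le_self_add) (hgauge a ha)
  have hE : ∀ a : ℝ, 0 < a → ENNReal.ofReal (a ^ ρ) *
      cknE a (0 : ℝ × EuclideanSpace ℝ (Fin 3)) H ≤ (c : ℝ≥0∞) :=
    fun a ha => le_trans (le_trans le_add_self le_self_add) (hgauge a ha)
  obtain ⟨-, cA, cE, hcA, -, hbA', -⟩ :=
    NeedleRace.needleBudgets_of_selfSimilarC2_past hρ hρ1 hT₁ hTT₁ x₀ hsw.distributional hH hA hE hu hp hV
  set CA : ℝ := cA + 1 with hCA
  have hCApos : 0 < CA := by rw [hCA]; linarith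
  have hbA : ∀ R : ℝ, 1 ≤ R →
      ∫ x in ball (0 : EuclideanSpace ℝ (Fin 3)) (3 * R), ‖V x‖ ^ 2 ≤ CA * (3 * R) ^ (1 - 2 * ρ) := by
    intro R hR
    have h3R1 : (1 : ℝ) ≤ 3 * R := by linarith
    have h3R0 : (0 : ℝ) < 3 * R := by linarith
    have hX : 0 ≤ CA * (3 * R) ^ (1 - 2 * ρ) := by positivity
    refine setIntegral_sq_le_of_lintegral hV.continuous hX
      (((lintegral_mono_set ball_subset_closedBall).trans (hbA' (3 * R) h3R1)).trans ?_)
    exact ENNReal.ofReal_le_ofReal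
      (mul_le_mul_of_nonneg_right (by rw [hCA]; linarith) (Real.rpow_nonneg h3R0.le _))
  -- ### E in o-FORM from the weighted dissipation integral, with the constant (T2) demands
  have h3 : 0 < (3 : ℝ) ^ (1 - ρ) := Real.rpow_pos_of_pos (by norm_num) _
  set CE : ℝ := Real.pi * (1 / (2 + ρ)) ^ 2 / (256 * (3 : ℝ) ^ (1 - ρ) * C₁) with hCE
  have hCEpos : 0 < CE := by
    have : 0 < Real.pi := Real.pi_pos
    rw [hCE]; positivity
  have hCκ : C₁ ≤ Real.pi * (1 / (2 + ρ)) ^ 2 / (128 * (3 : ℝ) ^ (1 - ρ) * CE) / 2 := by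
    rw [hCE]
    have hπ : 0 < Real.pi := Real.pi_pos
    have hγ2 : 0 < (1 / (2 + ρ)) ^ 2 := by positivity
    rw [show Real.pi * (1 / (2 + ρ)) ^ 2 / (128 * (3 : ℝ) ^ (1 - ρ) *
        (Real.pi * (1 / (2 + ρ)) ^ 2 / (256 * (3 : ℝ) ^ (1 - ρ) * C₁))) / 2 = C₁ by
      field_simp; ring]
  obtain ⟨L₀, hL₀1, hL₀⟩ := lintegral_fderiv_sq_closedBall_eventually_le hρ1' hV1 hEw hCEpos
  have hbE : ∀ R : ℝ, L₀ ≤ R →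
      ∫ x in ball (0 : EuclideanSpace ℝ (Fin 3)) (3 * R), ‖fderiv ℝ V x‖ ^ 2 ≤ CE * (3 * R) ^ (1 - ρ) := by
    intro R hR
    have hR1 : 1 ≤ R := hL₀1.trans hR
    have h3R : L₀ ≤ 3 * R := by linarith
    have h3R0 : (0 : ℝ) < 3 * R := by linarith
    have h1 := hL₀ (3 * R) h3R
    have h2 : ∫⁻ z in ball (0 : EuclideanSpace ℝ (Fin 3)) (3 * R), ‖fderiv ℝ V z‖ₑ ^ 2 ≤
        ENNReal.ofReal (CE * (3 * R) ^ (1 - ρ)) :=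
      (lintegral_mono_set ball_subset_closedBall).trans h1
    have hY : 0 ≤ CE * (3 * R) ^ (1 - ρ) := by positivity
    exact setIntegral_sq_le_of_lintegral (hV.continuous_fderiv (by norm_num)) hY h2
  -- ### (T2): the profile is irrotational; conclusion by the past irrotational kill
  have hcurl : ∀ x : EuclideanSpace ℝ (Fin 3), curl V x = 0 :=
    curl_eq_zero_of_typeGradient_le hρ hρ1 hprof hV hCApos hCEpos hbA hbE hCκ hgrad₁
  exact Past.selfSimilar_ae_eq_zero_of_irrotationalC2_profile hρ hρ1 hT₁ hTT₁ x₀ hsw hH hgauge hu hp hV hcurl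

end Summit.NavierStokesRegularity.NavierStokesRegularity.Theorems.PowerGaugeEulerLiouville.Condenser

end
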